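import Summits.NavierStokesRegularity.NavierStokesRegularity.Theorems.FilamentSkeletonRssCoreLinearInvertibilityArnoldModeSplitToolsA
import Literature.Analysis.FluidPDE.GaussianVortexKernelRadial

/-!
# Tools for stub `stub_arnoldModeSplit` (crux `CoreLinearInvertibility`, stmt-NavierStokesRegularity-17973,
# route `FilamentSkeletonRss`, line `Sketch`) — part B: polar coordinates

With the notation of part A (`a`, `b` the `k = ±1` circle coefficients of a continuous Gaussian-class
density `ω`, `ω₁` its `k = ±1` part, `ω_r = ω − ω₁`), polar coordinates on `ℝ²`
(`integral_eq_integral_circlePt` of `PlanarPolarCoords`) give: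

* the first moments `∫ x₀ ω = π ∫₀^∞ r² a(r) dr`, `∫ x₁ ω = π ∫₀^∞ r² b(r) dr`;
* **orthogonality in `L²(Φ⁻¹)`** (`Φ = kerWeight`):
  `∫ Φ⁻¹ ω² = π ∫₀^∞ Φ(r)⁻¹ (a² + b²) r dr + ∫ Φ⁻¹ ω_r²` (circle by circle, the cross term
  `∫ (a cos θ + b sin θ) ω_r(circlePt r θ) dθ` vanishes and `∫ (a cos θ + b sin θ)² dθ = π(a² + b²)`).

Reference: Th. Gallay, V. Šverák, arXiv:2110.13739, §3 (proof of Thm. 2.5). Folklore.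
-/

set_option linter.dupNamespace false

noncomputable section

namespace Summit.NavierStokesRegularity.NavierStokesRegularity.Theorems

open Set Function Filter MeasureTheory Topology
open Literature.Analysis.FluidPDE
open scoped Real

section Polar

variable {om : EuclideanSpace ℝ (Fin 2) → ℝ} {a b : ℝ → ℝ} {om₁ omr : EuclideanSpace ℝ (Fin 2) → ℝ}

/-! ### First moments in polar coordinates -/

/-- **`∫ x₀ ω = π ∫₀^∞ r² a(r) dr`** (polar coordinates; `a = π⁻¹ ∫ ω(circlePt r θ) cos θ dθ`). [folklore] -/
theorem modeSplit_integral_coord_zero_mul (hom : Continuous om)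
    (hgc : ∃ (C : ℝ) (N : ℕ), ∀ x, |om x| ≤ C * (1 + ‖x‖) ^ N * Real.exp (-(‖x‖ ^ 2 / 4)))
    (ha : ∀ r, a r = (1 / Real.pi) * ∫ θ in (-Real.pi)..Real.pi, om (circlePt r θ) * Real.cos θ) :
    ∫ x : EuclideanSpace ℝ (Fin 2), x 0 * om x = π * ∫ r in Ioi (0 : ℝ), r ^ 2 * a r := by
  have hπ : -π ≤ π := by linarith [Real.pi_pos]
  have hint : Integrable fun x : EuclideanSpace ℝ (Fin 2) => x 0 * om x :=
    (arnold_integrable_of_gc hom.aestronglyMeasurable hgc).2.2 0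
  rw [integral_eq_integral_circlePt hint, ← integral_const_mul]
  refine setIntegral_congr_fun measurableSet_Ioi fun ρ _ => ?_
  have h1 : ∀ θ : ℝ, ρ • (circlePt ρ θ 0 * om (circlePt ρ θ)) =
      ρ ^ 2 * (om (circlePt ρ θ) * Real.cos θ) := fun θ => by
    rw [circlePt_apply_zero, smul_eq_mul]; ring
  simp_rw [h1]
  rw [integral_const_mul, ← intervalIntegral.integral_of_le hπ, modeSplit_circleInt_eq_pi_mul ha ρ]
  ring

/-- **`∫ x₁ ω = π ∫₀^∞ r² b(r) dr`**. [folklore] -/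
theorem modeSplit_integral_coord_one_mul (hom : Continuous om)
    (hgc : ∃ (C : ℝ) (N : ℕ), ∀ x, |om x| ≤ C * (1 + ‖x‖) ^ N * Real.exp (-(‖x‖ ^ 2 / 4)))
    (hb : ∀ r, b r = (1 / Real.pi) * ∫ θ in (-Real.pi)..Real.pi, om (circlePt r θ) * Real.sin θ) :
    ∫ x : EuclideanSpace ℝ (Fin 2), x 1 * om x = π * ∫ r in Ioi (0 : ℝ), r ^ 2 * b r := by
  have hπ : -π ≤ π := by linarith [Real.pi_pos]
  have hint : Integrable fun x : EuclideanSpace ℝ (Fin 2) => x 1 * om x :=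
    (arnold_integrable_of_gc hom.aestronglyMeasurable hgc).2.2 1
  rw [integral_eq_integral_circlePt hint, ← integral_const_mul]
  refine setIntegral_congr_fun measurableSet_Ioi fun ρ _ => ?_
  have h1 : ∀ θ : ℝ, ρ • (circlePt ρ θ 1 * om (circlePt ρ θ)) =
      ρ ^ 2 * (om (circlePt ρ θ) * Real.sin θ) := fun θ => by
    rw [circlePt_apply_one, smul_eq_mul]; ring
  simp_rw [h1]
  rw [integral_const_mul, ← intervalIntegral.integral_of_le hπ, modeSplit_circleInt_eq_pi_mul hb ρ]
  ring

/-- **The moment constraints on `a`, `b`**: `∫ x_j ω = 0` gives `∫₀^∞ r² a = 0`, `∫₀^∞ r² b = 0`.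
[folklore] -/
theorem modeSplit_moment_constraints (hom : Continuous om)
    (hgc : ∃ (C : ℝ) (N : ℕ), ∀ x, |om x| ≤ C * (1 + ‖x‖) ^ N * Real.exp (-(‖x‖ ^ 2 / 4)))
    (hm0 : ∫ x : EuclideanSpace ℝ (Fin 2), x 0 * om x = 0) (hm1 : ∫ x : EuclideanSpace ℝ (Fin 2), x 1 * om x = 0)
    (ha : ∀ r, a r = (1 / Real.pi) * ∫ θ in (-Real.pi)..Real.pi, om (circlePt r θ) * Real.cos θ)
    (hb : ∀ r, b r = (1 / Real.pi) * ∫ θ in (-Real.pi)..Real.pi, om (circlePt r θ) * Real.sin θ) :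
    ∫ r in Ioi (0 : ℝ), r ^ 2 * a r = 0 ∧ ∫ r in Ioi (0 : ℝ), r ^ 2 * b r = 0 := by
  have h0 := modeSplit_integral_coord_zero_mul hom hgc ha
  have h1 := modeSplit_integral_coord_one_mul hom hgc hb
  rw [hm0] at h0
  rw [hm1] at h1
  have hπ : (π : ℝ) ≠ 0 := Real.pi_pos.ne'
  exact ⟨(mul_eq_zero.1 h0.symm).resolve_left hπ, (mul_eq_zero.1 h1.symm).resolve_left hπ⟩

/-! ### Orthogonality in `L²(Φ⁻¹)` -/

/-- On the circle of radius `ρ > 0`: `∫ (a cos θ + b sin θ + ω_r)² − ω_r² dθ`-type identity, i.e.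
`∫_{(-π,π]} ρ Φ(ρ)⁻¹ (ω² − ω_r²)(circlePt ρ θ) dθ = π Φ(ρ)⁻¹ (a² + b²) ρ`. [folklore] -/
theorem modeSplit_circle_weighted_sq (hom : Continuous om)
    (ha : ∀ r, a r = (1 / Real.pi) * ∫ θ in (-Real.pi)..Real.pi, om (circlePt r θ) * Real.cos θ)
    (hb : ∀ r, b r = (1 / Real.pi) * ∫ θ in (-Real.pi)..Real.pi, om (circlePt r θ) * Real.sin θ)
    (hom₁ : ∀ x, om₁ x = (a ‖x‖ * x 0 + b ‖x‖ * x 1) / ‖x‖) (homr : ∀ x, omr x = om x - om₁ x)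
    (homrc : Continuous omr) {ρ : ℝ} (hρ : 0 < ρ) :
    ∫ θ in Ioc (-π) π, ρ • ((kerWeight ‖circlePt ρ θ‖)⁻¹ *
        (om (circlePt ρ θ) ^ 2 - omr (circlePt ρ θ) ^ 2)) =
      π * ((kerWeight ρ)⁻¹ * (a ρ ^ 2 + b ρ ^ 2) * ρ) := by
  have hπ : -π ≤ π := by linarith [Real.pi_pos]
  have key : ∀ θ : ℝ, ρ • ((kerWeight ‖circlePt ρ θ‖)⁻¹ *
      (om (circlePt ρ θ) ^ 2 - omr (circlePt ρ θ) ^ 2)) =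
      ρ * (kerWeight ρ)⁻¹ * (a ρ ^ 2 * Real.cos θ ^ 2 + b ρ ^ 2 * Real.sin θ ^ 2 +
        2 * (a ρ * b ρ) * (Real.sin θ * Real.cos θ) + 2 * a ρ * (omr (circlePt ρ θ) * Real.cos θ) +
        2 * b ρ * (omr (circlePt ρ θ) * Real.sin θ)) := by
    intro θ
    rw [norm_circlePt, abs_of_pos hρ, smul_eq_mul]
    have hom_eq : om (circlePt ρ θ) = a ρ * Real.cos θ + b ρ * Real.sin θ + omr (circlePt ρ θ) := by
      rw [homr, modeSplit_om₁_circlePt hom₁ hρ]; ring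
    rw [hom_eq]; ring
  simp_rw [key]
  rw [integral_const_mul, ← intervalIntegral.integral_of_le hπ]
  have i1 : IntervalIntegrable (fun θ => a ρ ^ 2 * Real.cos θ ^ 2) volume (-π) π :=
    (continuous_const.mul (Real.continuous_cos.pow 2)).intervalIntegrable _ _
  have i2 : IntervalIntegrable (fun θ => b ρ ^ 2 * Real.sin θ ^ 2) volume (-π) π :=
    (continuous_const.mul (Real.continuous_sin.pow 2)).intervalIntegrable _ _
  have i3 : IntervalIntegrable (fun θ => 2 * (a ρ * b ρ) * (Real.sin θ * Real.cos θ)) volume (-π) π :=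
    (continuous_const.mul (Real.continuous_sin.mul Real.continuous_cos)).intervalIntegrable _ _
  have i4 : IntervalIntegrable (fun θ => 2 * a ρ * (omr (circlePt ρ θ) * Real.cos θ)) volume (-π) π :=
    (modeSplit_intervalIntegrable_circle homrc Real.continuous_cos ρ _ _).const_mul _
  have i5 : IntervalIntegrable (fun θ => 2 * b ρ * (omr (circlePt ρ θ) * Real.sin θ)) volume (-π) π :=
    (modeSplit_intervalIntegrable_circle homrc Real.continuous_sin ρ _ _).const_mul _
  rw [intervalIntegral.integral_add (((i1.add i2).add i3).add i4) i5,
    intervalIntegral.integral_add ((i1.add i2).add i3) i4,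
    intervalIntegral.integral_add (i1.add i2) i3, intervalIntegral.integral_add i1 i2,
    intervalIntegral.integral_const_mul, intervalIntegral.integral_const_mul,
    intervalIntegral.integral_const_mul, intervalIntegral.integral_const_mul,
    intervalIntegral.integral_const_mul, modeSplit_integral_cos_sq, modeSplit_integral_sin_sq,
    modeSplit_integral_sin_mul_cos, modeSplit_omr_circle_cos hom ha hom₁ homr hρ,
    modeSplit_omr_circle_sin hom hb hom₁ homr hρ]
  ring

/-- **Orthogonality of the `k = ±1` part and the remainder in `L²(Φ⁻¹)`**:
`∫ Φ⁻¹ ω² = π ∫₀^∞ Φ(r)⁻¹ (a² + b²) r dr + ∫ Φ⁻¹ ω_r²`. [folklore] -/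
theorem modeSplit_weighted_sq_split (hom : Continuous om)
    (hgc : ∃ (C : ℝ) (N : ℕ), ∀ x, |om x| ≤ C * (1 + ‖x‖) ^ N * Real.exp (-(‖x‖ ^ 2 / 4)))
    (ha : ∀ r, a r = (1 / Real.pi) * ∫ θ in (-Real.pi)..Real.pi, om (circlePt r θ) * Real.cos θ)
    (hb : ∀ r, b r = (1 / Real.pi) * ∫ θ in (-Real.pi)..Real.pi, om (circlePt r θ) * Real.sin θ)
    (hom₁ : ∀ x, om₁ x = (a ‖x‖ * x 0 + b ‖x‖ * x 1) / ‖x‖) (homr : ∀ x, omr x = om x - om₁ x) :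
    ∫ x, (kerWeight ‖x‖)⁻¹ * om x ^ 2 =
      Real.pi * (∫ r in Set.Ioi (0 : ℝ), (kerWeight r)⁻¹ * (a r ^ 2 + b r ^ 2) * r) +
        ∫ x, (kerWeight ‖x‖)⁻¹ * omr x ^ 2 := by
  obtain ⟨C, N, hC⟩ := hgc
  have hac : Continuous a := modeSplit_continuous_coeff hom Real.continuous_cos ha
  have hbc : Continuous b := modeSplit_continuous_coeff hom Real.continuous_sin hb
  have hom₁c : Continuous om₁ := modeSplit_continuous_om₁ hac hbc
    (modeSplit_coeff_zero modeSplit_integral_cos ha) (modeSplit_coeff_zero modeSplit_integral_sin hb) hom₁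
  have homrc : Continuous omr := modeSplit_continuous_omr hom hom₁c homr
  have h1 : Integrable fun x : EuclideanSpace ℝ (Fin 2) => (kerWeight ‖x‖)⁻¹ * om x ^ 2 :=
    arnold_integrable_inv_kerWeight_mul_sq hom.aestronglyMeasurable ⟨C, N, hC⟩
  have h2 : Integrable fun x : EuclideanSpace ℝ (Fin 2) => (kerWeight ‖x‖)⁻¹ * omr x ^ 2 :=
    arnold_integrable_inv_kerWeight_mul_sq homrc.aestronglyMeasurable
      ⟨5 * C, N, modeSplit_omr_gaussClass hC ha hb hom₁ homr⟩
  have h12 : Integrable fun x : EuclideanSpace ℝ (Fin 2) => (kerWeight ‖x‖)⁻¹ * (om x ^ 2 - omr x ^ 2) :=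
    (h1.sub h2).congr (Eventually.of_forall fun x => by simp only [Pi.sub_apply]; ring)
  have hdiff : (∫ x, (kerWeight ‖x‖)⁻¹ * om x ^ 2) - ∫ x, (kerWeight ‖x‖)⁻¹ * omr x ^ 2 =
      ∫ x, (kerWeight ‖x‖)⁻¹ * (om x ^ 2 - omr x ^ 2) := by
    rw [← integral_sub h1 h2]
    exact integral_congr_ae (Eventually.of_forall fun x => by ring)
  suffices h : ∫ x, (kerWeight ‖x‖)⁻¹ * (om x ^ 2 - omr x ^ 2) =
      π * ∫ r in Set.Ioi (0 : ℝ), (kerWeight r)⁻¹ * (a r ^ 2 + b r ^ 2) * r by linarith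
  rw [integral_eq_integral_circlePt h12, ← integral_const_mul]
  exact setIntegral_congr_fun measurableSet_Ioi fun ρ hρ =>
    modeSplit_circle_weighted_sq hom ha hb hom₁ homr homrc hρ

end Polar

/-! ### The registered tools stub -/

/-- **Registered tools stub `stub_arnoldModeSplitToolsB`** (helpers for `stub_arnoldModeSplit`, line `Sketch`
of crux `CoreLinearInvertibility`, stmt-NavierStokesRegularity-17973): the first moments in polar coordinates,
`∫ x₀ ω = π ∫₀^∞ r² a`, `∫ x₁ ω = π ∫₀^∞ r² b`, and the orthogonality
`∫ Φ⁻¹ ω² = π ∫₀^∞ Φ⁻¹ (a² + b²) r dr + ∫ Φ⁻¹ ω_r²`. [folklore] -/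
theorem stub_arnoldModeSplitToolsB :
    ∀ (om : EuclideanSpace ℝ (Fin 2) → ℝ) (a b : ℝ → ℝ) (om₁ omr : EuclideanSpace ℝ (Fin 2) → ℝ),
    Continuous om →
    (∃ (C : ℝ) (N : ℕ), ∀ x, |om x| ≤ C * (1 + ‖x‖) ^ N * Real.exp (-(‖x‖ ^ 2 / 4))) →
    (∀ r, a r = (1 / Real.pi) * ∫ θ in (-Real.pi)..Real.pi, om (circlePt r θ) * Real.cos θ) →
    (∀ r, b r = (1 / Real.pi) * ∫ θ in (-Real.pi)..Real.pi, om (circlePt r θ) * Real.sin θ) →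
    (∀ x, om₁ x = (a ‖x‖ * x 0 + b ‖x‖ * x 1) / ‖x‖) →
    (∀ x, omr x = om x - om₁ x) →
    ∫ x : EuclideanSpace ℝ (Fin 2), x 0 * om x = Real.pi * ∫ r in Set.Ioi (0 : ℝ), r ^ 2 * a r ∧
    ∫ x : EuclideanSpace ℝ (Fin 2), x 1 * om x = Real.pi * ∫ r in Set.Ioi (0 : ℝ), r ^ 2 * b r ∧
    ∫ x, (kerWeight ‖x‖)⁻¹ * om x ^ 2 =
      Real.pi * (∫ r in Set.Ioi (0 : ℝ), (kerWeight r)⁻¹ * (a r ^ 2 + b r ^ 2) * r) +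
        ∫ x, (kerWeight ‖x‖)⁻¹ * omr x ^ 2 :=
  fun _ _ _ _ _ hom hgc ha hb hom₁ homr =>
    ⟨modeSplit_integral_coord_zero_mul hom hgc ha, modeSplit_integral_coord_one_mul hom hgc hb,
      modeSplit_weighted_sq_split hom hgc ha hb hom₁ homr⟩

end Summit.NavierStokesRegularity.NavierStokesRegularity.Theorems
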